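import Literature.NumberTheory.Automorphic.ParabolicIndGLNoSupercuspidalSubquotient   -- ★ `Representation.IsAdmissible.exists_hasCentralCharacter`
import Literature.NumberTheory.Automorphic.HeckeEigencharacterPackage               -- ★ `IrrClass.IsAdmissible`
import Mathlib.Analysis.Complex.Basic
import HarnessLib

/-!
# Central characters of smooth representations: continuity, and unitarity when the centre is compact

Generic facts about the central character `ω : Z(G) →* kˣ` of a smooth representation `ρ` of a topological group `G`
(`Representation.HasCentralCharacter`, ★ `SmoothRepresentation`):

* `Representation.IsSmooth.isOpen_setOf_centralCharacter_eq_one` / `….continuous_centralCharacter` — if `ρ` is smooth and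
  `V ≠ 0`, the central character is trivial on the open subgroup `Z(G) ∩ Stab(v₀)` (`v₀ ≠ 0`), hence locally constant, hence
  continuous for ANY topology on `k` (a «quasicharacter» of `Z(G)` in the sense of Bernstein–Zelevinsky).
* `Representation.IsSmooth.norm_centralCharacter_eq_one_of_isCompact_center` — over `ℂ`, if moreover the centre `Z(G)` is
  compact, the central character is UNITARY: `‖ω z‖ = 1` (a continuous homomorphism from a compact group to `ℂˣ` has
  bounded image, and a bounded subgroup of `ℝ_{>0}` is trivial).  Pointwise variant `…_of_forall_apply_eq_smul` in the
  currency `∀ z x, ρ z x = ω z • x` of ★ `UnitaryGroup.U3SquareIntegrableExponents`.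
* `Representation.IsAdmissible.exists_hasCentralCharacter_norm_eq_one` — Schur (★ `IsAdmissible.exists_hasCentralCharacter`)
  + the above: an admissible irreducible representation of a group with a compact open subgroup and compact centre has a
  unitary central character; bundled forms for ★ `SmoothIrrep` / ★ `IrrClass` (`IrrClass.IsAdmissible`,
  `IrrClass.HasCentralCharacter`).

This is the «(a) `ω` unitary — automatic when `Z(G)` is compact» clause of Casselman's square-integrability criterion as used
for `U(3)` at a non-split place [Rogawski1990 §12.2 p. 173]; the CM instance (centre of `U(Φ₃)(L⁺_v)` compact at non-split `v`,
★ `F0P3bLocalNonsplitCompactCenter`) is filed Summits-side.  Theorems only; no definitions, no named facts.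

## References
* I. N. Bernstein, A. V. Zelevinsky, *Representations of the group GL(n,F) where F is a non-archimedean local field*, Russian
  Math. Surveys 31:3 (1976), §2.10–2.11. [BernsteinZelevinsky1976]
* C. J. Bushnell, G. Henniart, *The local Langlands conjecture for GL(2)*, Springer 2006, §2.6 (Schur's lemma, Corollary 1). [BushnellHenniart2006]
* J. Rogawski, *Automorphic representations of unitary groups in three variables*, Ann. of Math. Stud. 123 (1990), §12.2 p. 173. [Rogawski1990]
-/

set_option autoImplicit false

noncomputable section

open Topology

namespace Representation

/-! ## §1 A continuous homomorphism from a compact group to `ℂˣ` is unitary -/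

/-- A group homomorphism `χ : Z →* ℂˣ` on a compact topological group, continuous as a map to `ℂ`, takes values of norm `1`
(the image of `‖χ‖` is a bounded subgroup of `ℝ_{>0}`).  Adapted from ★ `ContinuousMonoidHom.norm_apply_eq_one`
(`GaloisRepresentations/PadicCharacterCyclotomicFactorProofs`), restated for a bare `MonoidHom` + continuity. [folklore] -/
private theorem norm_monoidHom_apply_eq_one_of_compactSpace {Z : Type*} [Group Z] [TopologicalSpace Z] [CompactSpace Z]
    (χ : Z →* ℂˣ) (hχ : Continuous fun z => ((χ z : ℂˣ) : ℂ)) (z : Z) : ‖((χ z : ℂˣ) : ℂ)‖ = 1 := by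
  -- `‖χ‖` is bounded on the compact group
  obtain ⟨M, hM⟩ : ∃ M : ℝ, ∀ t : Z, ‖((χ t : ℂˣ) : ℂ)‖ ≤ M := by
    obtain ⟨M, hM⟩ := (isCompact_range hχ.norm).isBounded.bddAbove
    exact ⟨M, fun t => hM ⟨t, rfl⟩⟩
  -- hence `‖χ t‖ ≤ 1` for every `t` (else the powers blow up)
  have hle : ∀ t : Z, ‖((χ t : ℂˣ) : ℂ)‖ ≤ 1 := fun t => not_lt.mp fun hlt => by
    obtain ⟨n, hn⟩ := pow_unbounded_of_one_lt M hlt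
    have h := hM (t ^ n)
    rw [map_pow, Units.val_pow_eq_pow_val, norm_pow] at h
    exact (lt_irrefl M) (hn.trans_le h)
  -- and `‖χ z‖ ≥ 1` by applying this to `z⁻¹`
  refine le_antisymm (hle z) ?_
  have hinv := hle z⁻¹
  rw [map_inv, Units.val_inv_eq_inv_val, norm_inv] at hinv
  have hpos : 0 < ‖((χ z : ℂˣ) : ℂ)‖ := norm_pos_iff.2 (Units.ne_zero _)
  exact (inv_le_one₀ hpos).1 hinv

/-! ## §2 The central character of a smooth representation is locally constant, hence continuous -/

section Smooth

variable {k G V : Type*} [Field k] [Group G] [TopologicalSpace G] [SeparatelyContinuousMul G] [AddCommGroup V] [Module k V]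
  {ρ : Representation k G V} {ω : Subgroup.center G →* kˣ}

omit [TopologicalSpace G] [SeparatelyContinuousMul G] in
/-- If `ρ` has central character `ω` and `v₀ ≠ 0`, then `ω y = ω z` as soon as `z⁻¹ y` fixes `v₀`: the central character is
constant on the cosets of `Z(G) ∩ Stab(v₀)`. [cite: BernsteinZelevinsky1976, §2.10–2.11] [cite: BushnellHenniart2006, §2.6 Corollary 1] -/
theorem HasCentralCharacter.eq_of_apply_eq_self (hω : ρ.HasCentralCharacter ω) {v₀ : V} (hv₀ : v₀ ≠ 0)
    {z y : Subgroup.center G} (hy : ρ ((z : G)⁻¹ * (y : G)) v₀ = v₀) : ω y = ω z := by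
  have h : ((ω (z⁻¹ * y) : kˣ) : k) • v₀ = v₀ := by
    rw [← hω.apply, Subgroup.coe_mul, Subgroup.coe_inv]
    exact hy
  have h1 : ((ω (z⁻¹ * y) : kˣ) : k) = 1 := by
    by_contra hne
    apply hv₀
    have h0 : (((ω (z⁻¹ * y) : kˣ) : k) - 1) • v₀ = 0 := by rw [sub_smul, one_smul, h, sub_self]
    exact (smul_eq_zero.1 h0).resolve_left (sub_ne_zero.2 hne)
  have h2 : ω (z⁻¹ * y) = 1 := Units.ext h1
  rw [map_mul, map_inv, inv_mul_eq_one] at h2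
  exact h2.symm

/-- **The central character of a SMOOTH representation is continuous** (for any topology on `k`): with `v₀ ≠ 0`, it is constant
on the open neighbourhood `{y | z⁻¹ y ∈ Stab(v₀)}` of each `z ∈ Z(G)` (`Stab(v₀)` is open by smoothness) — i.e. `ω` is a
quasicharacter of `Z(G)`. [cite: BernsteinZelevinsky1976, §2.10–2.11] [cite: BushnellHenniart2006, §2.6 Corollary 1] -/
theorem IsSmooth.continuous_centralCharacter [TopologicalSpace k] (hρ : ρ.IsSmooth) [Nontrivial V]
    (hω : ρ.HasCentralCharacter ω) : Continuous fun z : Subgroup.center G => ((ω z : kˣ) : k) := by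
  obtain ⟨v₀, hv₀⟩ := exists_ne (0 : V)
  refine continuous_def.2 fun U _ => isOpen_iff_mem_nhds.2 fun z hz => ?_
  have hc : Continuous fun y : Subgroup.center G => (z : G)⁻¹ * (y : G) :=
    (continuous_const_mul ((z : G)⁻¹)).comp continuous_subtype_val
  have hO : IsOpen ((fun y : Subgroup.center G => (z : G)⁻¹ * (y : G)) ⁻¹' (ρ.stabilizerSubgroup v₀ : Set G)) :=
    (hρ v₀).preimage hc
  refine Filter.mem_of_superset (hO.mem_nhds ?_) fun y hy => ?_
  · show (z : G)⁻¹ * (z : G) ∈ (ρ.stabilizerSubgroup v₀ : Set G)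
    rw [inv_mul_cancel]
    exact (ρ.stabilizerSubgroup v₀).one_mem
  · have hy' : ρ ((z : G)⁻¹ * (y : G)) v₀ = v₀ := hy
    show ((ω y : kˣ) : k) ∈ U
    rw [hω.eq_of_apply_eq_self hv₀ hy']
    exact hz

end Smooth

/-! ## §3 Compact centre: the central character is unitary -/

section Unitary

variable {G V : Type*} [Group G] [TopologicalSpace G] [SeparatelyContinuousMul G] [AddCommGroup V] [Module ℂ V]
  {ρ : Representation ℂ G V}

/-- **A smooth representation of a group with COMPACT centre has unitary central character**: `‖ω z‖ = 1` for all `z ∈ Z(G)`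
(`ω` is continuous by smoothness, and a continuous homomorphism from a compact group to `ℂˣ` is unitary).  This is clause (a)
«`ω` unitary» of Casselman's square-integrability criterion, automatic for `U(3)(E_w∕F_v)` at a non-split place where
`Z = E¹_w` is compact. [cite: Rogawski1990, §12.2 p. 173] [cite: BernsteinZelevinsky1976, §2.10–2.11] -/
theorem IsSmooth.norm_centralCharacter_eq_one_of_isCompact_center (hρ : ρ.IsSmooth) [Nontrivial V]
    {ω : Subgroup.center G →* ℂˣ} (hω : ρ.HasCentralCharacter ω) (hZ : IsCompact (Subgroup.center G : Set G))
    (z : Subgroup.center G) : ‖((ω z : ℂˣ) : ℂ)‖ = 1 := by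
  haveI : CompactSpace (Subgroup.center G) := isCompact_iff_compactSpace.1 hZ
  exact norm_monoidHom_apply_eq_one_of_compactSpace ω (hρ.continuous_centralCharacter hω) z

/-- The same in the pointwise currency `∀ z x, ρ z x = ω z • x` (the shape of the `ω`-binder of ★
`UnitaryGroup.U3SquareIntegrableExponents`). [cite: Rogawski1990, §12.2 p. 173] [cite: BernsteinZelevinsky1976, §2.10–2.11] -/
theorem IsSmooth.norm_eq_one_of_forall_apply_eq_smul (hρ : ρ.IsSmooth) [Nontrivial V] (ω : Subgroup.center G →* ℂˣ)
    (hω : ∀ (z : Subgroup.center G) (x : V), ρ (z : G) x = ((ω z : ℂˣ) : ℂ) • x)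
    (hZ : IsCompact (Subgroup.center G : Set G)) (z : Subgroup.center G) : ‖((ω z : ℂˣ) : ℂ)‖ = 1 :=
  hρ.norm_centralCharacter_eq_one_of_isCompact_center (fun z' => LinearMap.ext (hω z')) hZ z

/-- **Schur + compact centre**: an admissible irreducible representation of a group having a compact open subgroup and a
compact centre has a (unique) central character, and it is unitary. [cite: BushnellHenniart2006, §2.6 Corollary 1]
[cite: BernsteinZelevinsky1976, Proposition 2.11] [cite: Rogawski1990, §12.2 p. 173] -/
theorem IsAdmissible.exists_hasCentralCharacter_norm_eq_one [ρ.IsIrreducible] (hρ : ρ.IsAdmissible)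
    {K₀ : Subgroup G} (hK₀o : IsOpen (K₀ : Set G)) (hK₀c : IsCompact (K₀ : Set G))
    (hZ : IsCompact (Subgroup.center G : Set G)) :
    ∃ ω : Subgroup.center G →* ℂˣ, ρ.HasCentralCharacter ω ∧ ∀ z, ‖((ω z : ℂˣ) : ℂ)‖ = 1 := by
  obtain ⟨ω, hω⟩ := hρ.exists_hasCentralCharacter hK₀o hK₀c
  haveI : Nontrivial V := IsIrreducible.nontrivial ρ
  exact ⟨ω, hω, hρ.isSmooth.norm_centralCharacter_eq_one_of_isCompact_center hω hZ⟩

/-- Pointwise currency of `IsAdmissible.exists_hasCentralCharacter_norm_eq_one`. [cite: BushnellHenniart2006, §2.6 Corollary 1]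
[cite: Rogawski1990, §12.2 p. 173] -/
theorem IsAdmissible.exists_forall_apply_eq_smul_norm_eq_one [ρ.IsIrreducible] (hρ : ρ.IsAdmissible)
    {K₀ : Subgroup G} (hK₀o : IsOpen (K₀ : Set G)) (hK₀c : IsCompact (K₀ : Set G))
    (hZ : IsCompact (Subgroup.center G : Set G)) :
    ∃ ω : Subgroup.center G →* ℂˣ,
      (∀ (z : Subgroup.center G) (x : V), ρ (z : G) x = ((ω z : ℂˣ) : ℂ) • x) ∧ ∀ z, ‖((ω z : ℂˣ) : ℂ)‖ = 1 := by
  obtain ⟨ω, hω, h1⟩ := hρ.exists_hasCentralCharacter_norm_eq_one hK₀o hK₀c hZ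
  exact ⟨ω, hω.apply, h1⟩

end Unitary

end Representation

/-! ## §4 Bundled forms: `SmoothIrrep`, `IrrClass` -/

namespace Literature.NumberTheory.Automorphic

variable {G : Type*} [Group G] [TopologicalSpace G] [SeparatelyContinuousMul G]

/-- An admissible irreducible smooth representation (bundled, ★ `SmoothIrrep`) of a group with a compact open subgroup and
compact centre has a unitary central character. [cite: BushnellHenniart2006, §2.6 Corollary 1] [cite: Rogawski1990, §12.2 p. 173] -/
theorem SmoothIrrep.exists_hasCentralCharacter_norm_eq_one (r : SmoothIrrep G) (hr : r.ρ.IsAdmissible)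
    {K₀ : Subgroup G} (hK₀o : IsOpen (K₀ : Set G)) (hK₀c : IsCompact (K₀ : Set G))
    (hZ : IsCompact (Subgroup.center G : Set G)) :
    ∃ ω : Subgroup.center G →* ℂˣ, r.HasCentralCharacter ω ∧ ∀ z, ‖((ω z : ℂˣ) : ℂ)‖ = 1 :=
  hr.exists_hasCentralCharacter_norm_eq_one hK₀o hK₀c hZ

/-- **Class form** (★ `IrrClass`, `IrrClass.IsAdmissible`, `IrrClass.HasCentralCharacter`): an admissible irreducible class of a
group with a compact open subgroup and compact centre has a unitary central character. [cite: BushnellHenniart2006, §2.6 Corollary 1]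
[cite: Rogawski1990, §12.2 p. 173] -/
theorem IrrClass.exists_hasCentralCharacter_norm_eq_one (c : IrrClass G) (hc : c.IsAdmissible)
    {K₀ : Subgroup G} (hK₀o : IsOpen (K₀ : Set G)) (hK₀c : IsCompact (K₀ : Set G))
    (hZ : IsCompact (Subgroup.center G : Set G)) :
    ∃ ω : Subgroup.center G →* ℂˣ, c.HasCentralCharacter ω ∧ ∀ z, ‖((ω z : ℂˣ) : ℂ)‖ = 1 := by
  induction c using IrrClass.ind with
  | h r => exact r.exists_hasCentralCharacter_norm_eq_one ((IrrClass.isAdmissible_mk r).1 hc) hK₀o hK₀c hZ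

end Literature.NumberTheory.Automorphic

end
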